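import Summits.Ventures.Crystal3D.StickySpheres.SevenCensusPatterns
import Summits.Ventures.Crystal3D.StickySpheres.RadiusOne
import HarnessLib

/-!
# Integer-model witnesses: four of the five seven-ball contact graphs are realised

Venture `Crystal3D` (cell `pub-crystal3d`, seat p2). Companion of `SevenCensus.lean` (the "at most five graphs" half of the
seven-ball census). Here: the graphs `tricap` (tri-capped tetrahedron), `capoct` (capped octahedron), `axial` (four
tetrahedra about an edge) and `helix` (four-tetrahedra helix) of `SevenCensusPatterns.lean` ARE contact graphs of packings of
seven unit-diameter balls with exactly fifteen contacts — by explicit INTEGER models (all centres in `(1/√m)·ℤ³`, contact at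
integer squared distance `m = 18, 18, 162, 1458`; polytetrahedral clusters live in `ℚ ⊗ fcc` because a cap is the rational
reflection `(2/3)(Q + R + S) − P`), checked by `decide` and transported by the tree's `intConfig` lemmas (`RadiusOne.lean`).
The fifth graph, the pentagonal bipyramid `bipyr`, has no integer model (its Gram matrix involves `√5`) and is NOT treated
here.

HONEST FRAMING: four explicit packings and kernel arithmetic; no enumeration claim and nothing about crystallization.
-/

noncomputable section

namespace Summit.Ventures.Crystal3D

open Literature.Geometry.DiscreteGeometry (sqNormInt)
open Literature.Barriers.AtomisticToContinuum (intContactNumber intConfig)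
open SevenSearch SevenCensus

/-- From an integer model to a unit-diameter packing with prescribed contact slots. [folklore] -/
theorem realised_of_intModel (c : Fin 7 → Fin 3 → ℤ) {m : ℕ} (hm : 0 < m) (l : List (V × V))
    (hsep : ∀ i j : Fin 7, i ≠ j → (m : ℤ) ≤ sqNormInt (c i - c j)) (hcount : intContactNumber c m = 15)
    (hpat : ∀ a b : Fin 7, a ≠ b → (sqNormInt (c a - c b) = m ↔ (maskOf l).testBit (pidx a b) = true)) :
    ∃ x : Fin 7 → EuclideanSpace ℝ (Fin 3), IsUnitPacking x ∧ numContacts x = 15 ∧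
      ∀ a b : Fin 7, a ≠ b → (dist (x a) (x b) = 1 ↔ (maskOf l).testBit (pidx a b) = true) := by
  refine ⟨intConfig c (1 / Real.sqrt m), isUnitPacking_intConfig c hm hsep, (numContacts_intConfig c hm).trans hcount,
    fun a b hab => ?_⟩
  rw [← hpat a b hab, dist_intConfig_inv_sqrt c hm, Real.sqrt_eq_one]
  have hmR : (0 : ℝ) < m := by exact_mod_cast hm
  rw [div_eq_one_iff_eq hmR.ne']
  constructor
  · intro h; exact_mod_cast h
  · intro h; exact_mod_cast h

/-- Tri-capped tetrahedron: tetrahedron `(0,0,0),(3,3,0),(3,0,3),(0,3,3)` (labels `3,4,5,6`) with the caps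
`(−1,4,−1), (−1,−1,4), (4,4,4)` (labels `0,1,2`); contact at squared distance `18`. [folklore] -/
def tricapInt : Fin 7 → Fin 3 → ℤ :=
  ![![-1, 4, -1], ![-1, -1, 4], ![4, 4, 4], ![0, 0, 0], ![3, 3, 0], ![3, 0, 3], ![0, 3, 3]]

/-- Capped octahedron: octahedron `(±3,0,0),(0,±3,0),(0,0,±3)` with the cap `(3,3,3)` (label `2`); contact at `18`.
[folklore] -/
def capoctInt : Fin 7 → Fin 3 → ℤ :=
  ![![3, 0, 0], ![-3, 0, 0], ![3, 3, 3], ![0, -3, 0], ![0, 3, 0], ![0, 0, -3], ![0, 0, 3]]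

/-- Four tetrahedra about the edge `(0,0,0)(9,9,0)` (labels `5,6`) with the open ring
`(12,−3,−3),(9,0,9),(0,9,9),(−3,12,−3),(4,5,−11)` (labels `1,3,0,4,2`); contact at `162`. [folklore] -/
def axialInt : Fin 7 → Fin 3 → ℤ :=
  ![![0, 9, 9], ![12, -3, -3], ![4, 5, -11], ![9, 0, 9], ![-3, 12, -3], ![0, 0, 0], ![9, 9, 0]]

/-- Four face-sharing tetrahedra (tetrahelix segment) at scale `27`: `(0,0,0),(27,27,0),(27,0,27),(0,27,27)` and the successive
reflections `(36,36,36),(15,15,60),(7,52,55)`; contact at `1458`. [folklore] -/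
def helixInt : Fin 7 → Fin 3 → ℤ :=
  ![![27, 27, 0], ![15, 15, 60], ![0, 0, 0], ![7, 52, 55], ![27, 0, 27], ![36, 36, 36], ![0, 27, 27]]

/-- **`tricap` is realised** with exactly its fifteen contacts. [folklore] -/
theorem tricap_realised : ∃ x : Fin 7 → EuclideanSpace ℝ (Fin 3), IsUnitPacking x ∧ numContacts x = 15 ∧
    ∀ a b : Fin 7, a ≠ b → (dist (x a) (x b) = 1 ↔ (maskOf (tricapEdges (0, 1, 2, 3, 4, 5, 6))).testBit (pidx a b) = true) :=
  realised_of_intModel tricapInt (m := 18) (by norm_num) _ (by decide) (by decide) (by decide)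

/-- **`capoct` is realised** with exactly its fifteen contacts. [folklore] -/
theorem capoct_realised : ∃ x : Fin 7 → EuclideanSpace ℝ (Fin 3), IsUnitPacking x ∧ numContacts x = 15 ∧
    ∀ a b : Fin 7, a ≠ b → (dist (x a) (x b) = 1 ↔ (maskOf (capoctEdges (0, 1, 2, 3, 4, 5, 6))).testBit (pidx a b) = true) :=
  realised_of_intModel capoctInt (m := 18) (by norm_num) _ (by decide) (by decide) (by decide)

/-- **`axial` is realised** with exactly its fifteen contacts. [folklore] -/
theorem axial_realised : ∃ x : Fin 7 → EuclideanSpace ℝ (Fin 3), IsUnitPacking x ∧ numContacts x = 15 ∧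
    ∀ a b : Fin 7, a ≠ b → (dist (x a) (x b) = 1 ↔ (maskOf (axialEdges (0, 1, 2, 3, 4, 5, 6))).testBit (pidx a b) = true) :=
  realised_of_intModel axialInt (m := 162) (by norm_num) _ (by decide) (by decide) (by decide)

/-- **`helix` is realised** with exactly its fifteen contacts. [folklore] -/
theorem helix_realised : ∃ x : Fin 7 → EuclideanSpace ℝ (Fin 3), IsUnitPacking x ∧ numContacts x = 15 ∧
    ∀ a b : Fin 7, a ≠ b → (dist (x a) (x b) = 1 ↔ (maskOf (helixEdges (0, 1, 2, 3, 4, 5, 6))).testBit (pidx a b) = true) :=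
  realised_of_intModel helixInt (m := 1458) (by norm_num) _ (by decide) (by decide) (by decide)

end Summit.Ventures.Crystal3D

end
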